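import Summits.CriticalPhenomena.CardyFormulaZ2.Theorems.CardyBoundaryCoulombGasRectilinearCardyStubBoundaryFeetPart9
import HarnessLib

/-!
# Stub `stub_boundaryFeet` of line `excursion-kernel-covariance` — Part 10: the registered stub
# (assembly) (crux `RectilinearCardy`, stmt-CriticalPhenomena-5660)

**Theorem `stub_boundaryFeet`** (registered stub W of the line skeleton
`Lines/excursion_kernel_covariance.lean`, verbatim): for a Jordan domain with rectilinear frontier,
positively oriented at one boundary parameter, and `η > 0`, for all small meshes `δ` the exterior
darts of the closure lattice polygon `V = {v : δ v ∈ closure D}` form ONE `dsucc`-cycle carrying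
non-decreasing lifted feet which increase by `< η` per step and by exactly `1` per period, sit within
`η` of the darts' mesh points, are exact (straight ahead within `δ`), no vertex has three outside
neighbours, and lattice convex corners are passed straight through their two row neighbours.

Assembly of Parts 1–9: the feet are the foot parameters `bftPar` (Part 2) of the darts; the uniform
oriented wedges (Part 2, `bft_uniform_wedge`) and the tube lemma (`tp_tube`) make the three local
hypotheses of the cyclic-order lemma hold at every exterior dart (Part 8, `bft_local`), so the
cyclic-order lemma (Part 1, `bft_cyclic`) gives one cycle with lifted feet winding once; the distance
and exactness clauses are the definition of the foot (`bft_foot_spec`, `bft_par_spec`); the last two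
clauses are read in the frame chart about the vertex (Part 3 `bft_frame_chart`, Part 9
`bft_card_le_two`, `bft_corner_local`) with injectivity of the walk (`s3_dsucc_injective`).
-/

noncomputable section

open Set Filter Metric Topology
open Literature.Probability.RandomPlanarGeometry
open Literature.Probability.LatticeModels Literature.Probability.LatticeModels.CollarLegModel
open Summit.CriticalPhenomena.CardyFormulaZ2.Cruxes.BoundaryDefectGaussianR.RainbowMonomialsInExcursionKernels

namespace Summit.CriticalPhenomena.CardyFormulaZ2.Cruxes.RectilinearCardy.ExcursionKernelCovariance

/-- A lattice point whose mesh point is within `2 δ` of a given point (coordinatewise floor).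
[folklore] -/
theorem bft_exists_mesh_near {δ : ℝ} (hδ : 0 < δ) (z : ℂ) :
    ∃ v : ℤ × ℤ, dist (bftMesh δ v) z < 2 * δ := by
  refine ⟨(⌊z.re / δ⌋, ⌊z.im / δ⌋), ?_⟩
  obtain ⟨-, -, h1, h2⟩ := bft_round hδ z.re
  obtain ⟨-, -, h3, h4⟩ := bft_round hδ z.im
  rw [dist_comm, Complex.dist_eq]
  refine lt_of_le_of_lt (Complex.norm_le_abs_re_add_abs_im _) ?_
  have hre : (z - bftMesh δ (⌊z.re / δ⌋, ⌊z.im / δ⌋)).re = z.re - δ * ⌊z.re / δ⌋ := by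
    simp [bftMesh]; ring
  have him : (z - bftMesh δ (⌊z.re / δ⌋, ⌊z.im / δ⌋)).im = z.im - δ * ⌊z.im / δ⌋ := by
    simp [bftMesh]; ring
  rw [hre, him, abs_of_nonneg h1, abs_of_nonneg h3]
  linarith

/-- **A nonempty finite lattice set has an exterior dart**: at a vertex of maximal abscissa the
eastward dart points outside. [folklore] -/
theorem bft_exists_exterior {V : Finset (ℤ × ℤ)} (hV : V.Nonempty) :
    ∃ d : Dart, d.1 ∈ V ∧ dartTip d ∉ V := by
  obtain ⟨v, hv, hmax⟩ := V.exists_max_image Prod.fst hV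
  refine ⟨(v, 0), hv, fun h => ?_⟩
  have := hmax _ h
  rw [dartTip, tp_dir_val.1] at this
  simp at this

/-- The vertex of the boundary successor of `(u, k)` is `u` only at a convex turn:
`(dsucc V (u, k)).1 = u → u + dir (k + 1) ∉ V`. [folklore] -/
theorem bft_turn_of_fst_eq (V : Finset (ℤ × ℤ)) (u : ℤ × ℤ) (k : Fin 4)
    (h : (dsucc V (u, k)).1 = u) : u + dir (k + 1) ∉ V := by
  intro hin
  have hne1 : ∀ k : Fin 4, dir k ≠ 0 := by decide
  have hne2 : ∀ k : Fin 4, dir (k + 1) + dir k ≠ 0 := by decide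
  obtain ⟨-, h2, h3⟩ := rb_dsucc_cases V u k
  by_cases hB : u + dir (k + 1) + dir k ∈ V
  · rw [h3 hin hB] at h
    exact hne2 k (by simpa [add_assoc] using h)
  · rw [h2 hin hB] at h
    exact hne1 (k + 1) (by simpa using h)

/-- **Stub W — BOUNDARY FEET** (registered stub of line `excursion-kernel-covariance`, crux
`RectilinearCardy`): the boundary walk of the closure lattice polygon of a positively oriented
rectilinear Jordan domain follows the boundary loop. See the module docstring. [folklore] -/
theorem stub_boundaryFeet :
    ∀ (D : Literature.Probability.RandomPlanarGeometry.JordanDomain),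
      (∃ S : Finset (ℂ × ℂ), (∀ q ∈ S, q.1.re = q.2.re ∨ q.1.im = q.2.im) ∧
        frontier D.carrier ⊆ ⋃ q ∈ S, segment ℝ q.1 q.2) →
      (∃ t₁ : ℝ, ∃ τ : ℂ, ‖τ‖ = 1 ∧
        (∃ ε : ℝ, 0 < ε ∧ ∀ t ∈ Ioo t₁ (t₁ + ε), ∃ s : ℝ, 0 < s ∧ D.boundary t = D.boundary t₁ + (s : ℂ) * τ) ∧
        (∃ ε : ℝ, 0 < ε ∧ ∀ s ∈ Ioo (0 : ℝ) ε, D.boundary t₁ + (s : ℂ) * (τ * Complex.I) ∈ D.carrier)) →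
      ∀ η : ℝ, 0 < η → ∃ δ₀ : ℝ, 0 < δ₀ ∧ ∀ δ : ℝ, 0 < δ → δ < δ₀ →
        ∀ V : Finset (ℤ × ℤ),
          (∀ v : ℤ × ℤ, v ∈ V ↔ ((v.1 : ℂ) * δ + (v.2 : ℂ) * δ * Complex.I) ∈ closure D.carrier) →
          ∃ (P : ℕ) (e : ℕ → Literature.Probability.LatticeModels.CollarLegModel.Dart) (F : ℕ → ℝ),
            0 < P ∧ (∀ n, e (n + P) = e n) ∧
            (∀ n, e (n + 1) = Literature.Probability.LatticeModels.CollarLegModel.dsucc V (e n)) ∧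
            (∀ n, (e n).1 ∈ V ∧ Literature.Probability.LatticeModels.CollarLegModel.dartTip (e n) ∉ V) ∧
            (∀ d : Literature.Probability.LatticeModels.CollarLegModel.Dart, d.1 ∈ V →
              Literature.Probability.LatticeModels.CollarLegModel.dartTip d ∉ V → ∃ n, n < P ∧ e n = d) ∧
            (∀ n m, n < P → m < P → e n = e m → n = m) ∧
            (∀ n, F n ≤ F (n + 1)) ∧ (∀ n, F (n + 1) < F n + η) ∧ (∀ n, F (n + P) = F n + 1) ∧
            (∀ n, dist (D.boundary (F n)) (((e n).1.1 : ℂ) * δ + ((e n).1.2 : ℂ) * δ * Complex.I) ≤ η) ∧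
            (∀ n, ∀ ρ : ℝ, 4 * δ ≤ ρ →
              ((∀ z ∈ frontier D.carrier, dist z (((e n).1.1 : ℂ) * δ + ((e n).1.2 : ℂ) * δ * Complex.I) < ρ →
                  z.im = (((e n).1.1 : ℂ) * δ + ((e n).1.2 : ℂ) * δ * Complex.I).im) ∨
                (∀ z ∈ frontier D.carrier, dist z (((e n).1.1 : ℂ) * δ + ((e n).1.2 : ℂ) * δ * Complex.I) < ρ →
                  z.re = (((e n).1.1 : ℂ) * δ + ((e n).1.2 : ℂ) * δ * Complex.I).re)) →
              ∃ s : ℝ, 0 ≤ s ∧ s ≤ δ ∧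
                D.boundary (F n) = (((e n).1.1 : ℂ) * δ + ((e n).1.2 : ℂ) * δ * Complex.I) +
                  (s : ℂ) * (((Literature.Probability.LatticeModels.CollarLegModel.dir (e n).2).1 : ℂ) +
                    ((Literature.Probability.LatticeModels.CollarLegModel.dir (e n).2).2 : ℂ) * Complex.I)) ∧
            (∀ n, ((Literature.Probability.LatticeModels.CollarLegModel.neighbours (e n).1).filter
              (fun y ↦ y ∉ V)).card ≤ 2) ∧
            (∀ n, (e (n + 2)).1 = (e (n + 1)).1 →
              (e (n + 2)).2 = (e (n + 1)).2 + 1 ∧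
              e n = ((e (n + 1)).1 + Literature.Probability.LatticeModels.CollarLegModel.dir ((e (n + 1)).2 + 3),
                (e (n + 1)).2) ∧
              e (n + 3) = ((e (n + 1)).1 + Literature.Probability.LatticeModels.CollarLegModel.dir ((e (n + 1)).2 + 2),
                (e (n + 1)).2 + 1) ∧
              ((Literature.Probability.LatticeModels.CollarLegModel.neighbours (e n).1).filter (fun y ↦ y ∉ V)).card = 1 ∧
              ((Literature.Probability.LatticeModels.CollarLegModel.neighbours (e (n + 3)).1).filter
                (fun y ↦ y ∉ V)).card = 1) := by
  intro D hrect hor η hη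
  obtain ⟨S, hS, hcov⟩ := hrect
  obtain ⟨t₁, τ, hτ, hor1, hor2⟩ := hor
  -- uniform oriented wedges, the tube constant, an interior disc
  obtain ⟨r₀, hr₀, hW⟩ := bft_uniform_wedge D hS hcov (t₁ := t₁) ⟨τ, hτ, hor1, hor2⟩
  set η' : ℝ := min η (1 / 4) with hη'def
  have hη'0 : 0 < η' := lt_min hη (by norm_num)
  have hη'4 : η' ≤ 1 / 4 := min_le_right _ _
  have hη'η : η' ≤ η := min_le_left _ _
  obtain ⟨c, hc, htube0⟩ := tp_tube D hη'0 (by linarith)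
  have htube : ∀ s t : ℝ, dist (D.boundary s) (D.boundary t) < c → ∃ n : ℤ, |s - t - n| < η' := by
    intro s t hst
    by_contra h
    exact (not_le.2 hst) (htube0 s t fun n => le_of_not_gt fun hn => h ⟨n, hn⟩)
  obtain ⟨z₀, hz₀⟩ := D.nonempty
  obtain ⟨ρ₀, hρ₀, hballρ⟩ := Metric.isOpen_iff.1 D.isOpen z₀ hz₀
  refine ⟨min (min (c / 4) (r₀ / 16)) (min η (ρ₀ / 2)), by positivity, ?_⟩
  intro δ hδ hδ₀ V hV
  have hm1 : min (min (c / 4) (r₀ / 16)) (min η (ρ₀ / 2)) ≤ c / 4 :=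
    (min_le_left _ _).trans (min_le_left _ _)
  have hm2 : min (min (c / 4) (r₀ / 16)) (min η (ρ₀ / 2)) ≤ r₀ / 16 :=
    (min_le_left _ _).trans (min_le_right _ _)
  have hm3 : min (min (c / 4) (r₀ / 16)) (min η (ρ₀ / 2)) ≤ η :=
    (min_le_right _ _).trans (min_le_left _ _)
  have hm4 : min (min (c / 4) (r₀ / 16)) (min η (ρ₀ / 2)) ≤ ρ₀ / 2 :=
    (min_le_right _ _).trans (min_le_right _ _)
  have hδc : 2 * δ < c := by linarith
  have hδr₀ : 16 * δ < r₀ := by linarith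
  have hδη : δ ≤ η := by linarith
  have hδρ : 2 * δ < ρ₀ := by linarith
  have hV' : ∀ v : ℤ × ℤ, v ∈ V ↔ bftMesh δ v ∈ closure D.carrier := hV
  -- an exterior dart to start from
  have hVne : V.Nonempty := by
    obtain ⟨v, hv⟩ := bft_exists_mesh_near hδ z₀
    exact ⟨v, (hV' v).2 (subset_closure (hballρ (mem_ball.2 (by linarith))))⟩
  obtain ⟨d₀, h₀, h₀'⟩ := bft_exists_exterior hVne
  -- feet, and the local hypotheses of the cyclic-order lemma at every exterior dart
  have hfr : ∀ d : Dart, d.1 ∈ V → dartTip d ∉ V → bftPhi D δ d ∈ frontier D.carrier :=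
    fun d hd hdt => bft_phi_frontier D hδ.le d ((hV' _).1 hd) (fun h => hdt ((hV' _).2 h))
  have hf : ∀ d : Dart, d.1 ∈ V → dartTip d ∉ V → 0 ≤ bftPar D δ d ∧ bftPar D δ d < 1 :=
    fun d hd hdt => (bft_par_spec D d (hfr d hd hdt)).1
  have hloc : ∀ d : Dart, d.1 ∈ V → dartTip d ∉ V →
      bftInc V (bftPar D δ) d < η' ∧
      (∀ d'' : Dart, d''.1 ∈ V → dartTip d'' ∉ V → ∀ j : ℤ,
        bftPar D δ d < bftPar D δ d'' + j → bftPar D δ d'' + j ≤ bftPar D δ d + bftInc V (bftPar D δ) d →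
        d'' = dsucc V d ∨ d'' = dsucc V (dsucc V d)) ∧
      (bftInc V (bftPar D δ) d = 0 → bftInc V (bftPar D δ) (dsucc V d) ≠ 0) := by
    intro d hd hdt
    obtain ⟨t₀, r, ηw, a, m, _, hηw, hηw4, ha4, hm, hdirA, hmonoA, hrA, hdirB, hantiB, hrB,
      hfront, hdom, hball⟩ := hW _ (hfr d hd hdt)
    exact bft_local D hδ hV' hηw hηw4 ha4 hm hdirA hmonoA hrA hdirB hantiB hrB hfront hdom hη'4 htube
      hδc d hd hdt (fun z hz => hball z (by linarith))
  -- the frame chart about the vertex of an exterior dart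
  have hchart : ∀ d : Dart, d.1 ∈ V → dartTip d ∉ V → ∃ (m : ℕ) (K : Fin 4) (X Y : ℤ),
      (m = 1 ∨ m = 2 ∨ m = 3) ∧
      ∀ s t : ℤ, -2 ≤ s → s ≤ 2 → -2 ≤ t → t ≤ 2 →
        (d.1 + s • dir K + t • dir (K + 1) ∈ V ↔
          ((m = 1 → X ≤ d.1.1 * (dir K).1 + d.1.2 * (dir K).2 + s ∧
              Y ≤ d.1.1 * (dir (K + 1)).1 + d.1.2 * (dir (K + 1)).2 + t) ∧
            (m = 2 → Y ≤ d.1.1 * (dir (K + 1)).1 + d.1.2 * (dir (K + 1)).2 + t) ∧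
            (m = 3 → Y ≤ d.1.1 * (dir (K + 1)).1 + d.1.2 * (dir (K + 1)).2 + t ∨
              d.1.1 * (dir K).1 + d.1.2 * (dir K).2 + s ≤ X))) := by
    intro d hd hdt
    obtain ⟨t₀, r, ηw, a, m, _, _, _, ha4, hm, _, _, _, _, _, _, hfront, hdom, hball⟩ :=
      hW _ (hfr d hd hdt)
    obtain ⟨K, rfl⟩ : ∃ K : Fin 4, (K : ℕ) = a := ⟨⟨a, ha4⟩, rfl⟩
    have hclos := tp_closure_chart D hm hfront hdom
    have hdζ : dist (bftPhi D δ d) (bftMesh δ d.1) ≤ δ := (bft_dist_phi_mesh D hδ.le d ((hV' _).1 hd)).2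
    refine ⟨m, K, _, _, hm, bft_frame_chart D hδ hV' K hm hclos d.1 fun z hz => hball z ?_⟩
    rw [dist_comm] at hdζ
    linarith [dist_triangle z (bftMesh δ d.1) (bftPhi D δ d)]
  -- the cyclic-order lemma
  obtain ⟨hP0, hper, hnodup, hsurj, hliftP, hliftk, hmono, hsucc⟩ :=
    bft_cyclic V (bftPar D δ) hf (fun d hd hdt => lt_of_lt_of_le (hloc d hd hdt).1 (by linarith))
      (fun d d'' hd hdt => (hloc d hd hdt).2.1 d'') (fun d hd hdt => (hloc d hd hdt).2.2) d₀ h₀ h₀'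
  have hext : ∀ n, ((dsucc V)^[n] d₀).1 ∈ V ∧ dartTip ((dsucc V)^[n] d₀) ∉ V :=
    fun n => (s3_dsucc_iterate V n).1 d₀ h₀ h₀'
  have hstep : ∀ n, (dsucc V)^[n + 1] d₀ = dsucc V ((dsucc V)^[n] d₀) :=
    fun n => Function.iterate_succ_apply' (dsucc V) n d₀
  -- the lifted foot projects to the foot
  have hfoot : ∀ n, D.boundary (bftLift V (bftPar D δ) d₀ n) = bftPhi D δ ((dsucc V)^[n] d₀) := by
    intro n
    obtain ⟨k, hk⟩ := hliftk n
    rw [hk, bft_boundary_add_int, (bft_par_spec D _ (hfr _ (hext n).1 (hext n).2)).2]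
  refine ⟨period V d₀, fun n => (dsucc V)^[n] d₀, bftLift V (bftPar D δ) d₀, hP0, hper, hstep, hext,
    hsurj, hnodup, hmono, fun n => ?_, hliftP, fun n => ?_, fun n ρ _ _ => ?_, fun n => ?_, fun n heq => ?_⟩
  · -- increments are `< η`
    rw [hsucc n]
    linarith [(hloc _ (hext n).1 (hext n).2).1]
  · -- the foot is within `δ ≤ η` of the dart's mesh point
    rw [hfoot n]
    exact (bft_dist_phi_mesh D hδ.le _ ((hV' _).1 (hext n).1)).2.trans hδη
  · -- exactness: the foot is straight ahead within `δ`
    obtain ⟨⟨hs0, hsδ⟩, -, -⟩ := bft_foot_spec D hδ.le ((dsucc V)^[n] d₀) ((hV' _).1 (hext n).1)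
    exact ⟨bftFoot D δ ((dsucc V)^[n] d₀), hs0, hsδ, by rw [hfoot n]; rfl⟩
  · -- at most two outside neighbours
    obtain ⟨m, K, X, Y, hm, hch⟩ := hchart _ (hext n).1 (hext n).2
    exact bft_card_le_two V hm K X Y _ hch (hext n).1
  · -- a lattice convex corner is passed straight through its two row neighbours
    set u := ((dsucc V)^[n + 1] d₀).1 with hu
    set k := ((dsucc V)^[n + 1] d₀).2 with hk
    have he1 : (dsucc V)^[n + 1] d₀ = (u, k) := Prod.ext rfl rfl
    have hk0 : u + dir k ∉ V := by have := (hext (n + 1)).2; rwa [he1] at this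
    have huV : u ∈ V := by have := (hext (n + 1)).1; rwa [he1] at this
    have he2 : (dsucc V)^[n + 2] d₀ = dsucc V (u, k) := by rw [← he1]; exact hstep (n + 1)
    have hk1 : u + dir (k + 1) ∉ V := bft_turn_of_fst_eq V u k (by rw [← he2]; exact heq)
    obtain ⟨m, K, X, Y, hm, hch⟩ := hchart _ (hext (n + 1)).1 (hext (n + 1)).2
    rw [he1] at hch
    obtain ⟨hin3, hout3, hdsA, hdsB, hcA, hcB⟩ := bft_corner_local V hm K X Y u hch huV hk0 hk1
    have hturn : dsucc V (u, k) = (u, k + 1) := (rb_dsucc_cases V u k).1 hk1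
    have hen : (dsucc V)^[n] d₀ = (u + dir (k + 3), k) :=
      s3_dsucc_injective V _ _ (hext n).1 (hext n).2 hin3 hout3 (by rw [hdsA, ← hstep n, he1])
    have he3 : (dsucc V)^[n + 3] d₀ = (u + dir (k + 2), k + 1) := by
      rw [show n + 3 = n + 2 + 1 by ring, hstep (n + 2), he2, hturn, hdsB]
    refine ⟨?_, hen, he3, ?_, ?_⟩
    · show ((dsucc V)^[n + 2] d₀).2 = k + 1
      rw [he2, hturn]
    · show ((neighbours ((dsucc V)^[n] d₀).1).filter (fun y ↦ y ∉ V)).card = 1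
      rw [hen]; exact hcA
    · show ((neighbours ((dsucc V)^[n + 3] d₀).1).filter (fun y ↦ y ∉ V)).card = 1
      rw [he3]; exact hcB

end Summit.CriticalPhenomena.CardyFormulaZ2.Cruxes.RectilinearCardy.ExcursionKernelCovariance

end
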